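import Summits.HubbardSuperconductivity.HubbardSuperconductivity.Theorems.LiebTwinNoOnsiteODLROReducedChannelDomination
import HarnessLib

/-!
# Crux `NoOnsiteODLRO` (stmt-HubbardSuperconductivity-0933) — the on-site secant and the window-free
# coupling-transport ceiling `S ≤ (2L²/g)·(E(U) − E(U − g))`

Helper file of route-prover seat `LiebTwin-1` for the crux `NoOnsiteODLRO` (routes `LiebTwin`, `EnslavedA1g`),
serving the registered helper stub `stub_couplingTransportCeiling`: the ENERGY consequences of reduced-channel
domination (`LiebTwinNoOnsiteODLROReducedChannelDomination`), i.e. the provable part of the lever of crux idea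
`Cruxes/NoOnsiteODLRO/Ideas/shastry-secant-reduced-bcs.md` (Shastry secant + neutralisation):

* `posSemidef_hubbardTorus_sub_smul_pairField_sub`, `minEnergyOn_hubbardTorus_shift_le` — the repulsion ABSORBS
  a reduced `s`-wave BCS attraction: `hubbardTorus 2 L 1 U − c·P_sᴴP_s ≥ hubbardTorus 2 L 1 (U − 2L²c)` for
  `c ≥ 0`, as operators and hence for every sector energy (`minEnergyOn_mono_of_posSemidef_sub`, Loewner
  monotonicity of `minEnergyOn`). With `g = 2L²c`, `P_s = −√2η₀`: `E_K(H_U − (g/L²)η₀ᴴη₀) ≥ E_K(H_{U−g})`.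
* `smul_re_expect_le_minEnergyOn_sub` — the **on-site secant** (one-sided Feynman–Hellmann at `x = 0` for
  Shastry's coupling `H + x·PᴴP`; the card's `OnsiteSecant` in variational form): for every unit sector ground
  state `ψ` of a Hermitian `H`, `c·Re⟨ψ,PᴴPψ⟩ ≤ E_K(H) − E_K(H − c·PᴴP)`.
* `re_expect_pairField_sWave_le_couplingSecant` / `stub_couplingTransportCeiling` — **coupling-transport
  ceiling**: for every real `U`, every `g > 0`, every sector `(N, S^z = M)` and every unit ground eigenvector `ψ`
  of `hubbardTorus 2 L 1 U` there, `(g/2L²)·Re⟨ψ,P_sᴴP_sψ⟩ ≤ E(U) − E(U − g)` (`E(V)` the sector energy at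
  coupling `V`): `S ≤ 2L²` times a secant slope of the concave sector energy in `U`. No pair window, no
  `U`-shift of the spectrum, no Falk–Bruch step, every ground state with the same right-hand side.
* `re_expect_pairField_sWave_le_doublon_of_lt` — hence, by the supergradient inequality at the weaker coupling,
  `S(ψ_U) ≤ 2L²·⟨D⟩_{φ}` for ANY ground state `φ` of the same sector at ANY `U' < U` (Griffiths antitonicity in
  on-site form).

This does not prove the crux: as `g ↓ 0` the right-hand side tends to `2L²·∂⁻_U E = 2L²·max_GS⟨D⟩ = O(L⁴)`
(STRATEGY-CENSUS T4, "circular"). It is the exact inequality behind the card's kernel-checked transfer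
`crux ⇐ ReducedBCSStability` (`E(H_U) − E(H_U − (g/L²)η₀ᴴη₀) = o(L²)` for one fixed `g > 0`, OPEN), with the
repulsion spent once: that gain is at most `E(U) − E(U − g)`.

Sources: B. S. Shastry, J. Phys. A 30 (1997) L635, eq. (1); R. B. Griffiths, Phys. Rev. 152 (1966) 240, §II;
H. Tasaki, *Physics and Mathematics of Quantum Many-Body Systems* (2020), §2.1–2.2; V. Bach, E. H. Lieb,
J. P. Solovej, J. Stat. Phys. 76 (1994) 3 (the gHF shadow "repulsion never profits from pairing"). Folklore
bookkeeping on tree definitions; no definition and no named fact is introduced.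
-/

noncomputable section

set_option linter.dupNamespace false

namespace Summit.HubbardSuperconductivity.HubbardSuperconductivity.Theorems.NoOnsiteODLRO.ReducedChannel

open Matrix Finset
open Literature.Probability.LatticeModels Literature.MathematicalPhysics.QuantumLattice
open scoped ComplexOrder

/-! ### The repulsion absorbs a reduced BCS attraction -/

section Absorb

variable (L : ℕ) [NeZero L]

/-- **The repulsion absorbs a reduced `s`-wave BCS attraction.** For every `c ≥ 0` and every real `U`,
`hubbardTorus 2 L 1 U − c · P_sᴴP_s ≥ hubbardTorus 2 L 1 (U − 2L²c)` as operators on the whole Fock space: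
subtracting the reduced BCS term `c · P_sᴴP_s = (g/L²) · η₀ᴴη₀` (`g = 2L²c`, `P_s = −√2 η₀`) from the Hubbard
torus costs at most a shift `U ↦ U − g` of the on-site coupling (reduced-channel domination times `c`). The
operator form of "the repulsive Hubbard interaction contains the reduced `s`-channel with coefficient `+U`"
(crux idea `shastry-secant-reduced-bcs`, lever; Bach–Lieb–Solovej, J. Stat. Phys. 76 (1994) 3, Thm 1, is the
generalised-Hartree–Fock shadow "repulsion never profits from pairing"). [folklore] -/
theorem posSemidef_hubbardTorus_sub_smul_pairField_sub (U c : ℝ) (hc : 0 ≤ c) :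
    (hubbardTorus 2 L 1 U - (c : ℂ) • ((pairField sWave L)ᴴ * pairField sWave L) -
      hubbardTorus 2 L 1 (U - 2 * (L : ℝ) ^ 2 * c)).PosSemidef := by
  have hD : (∑ x : FermionTorus 2 L, numberOp x 0 * numberOp x 1 :
      Matrix (Finset (Orb (FermionTorus 2 L))) (Finset (Orb (FermionTorus 2 L))) ℂ) = hubbardTorus 2 L 0 1 :=
    (hubbardTorus_zero_one_eq_sum_doublon L).symm
  have key : hubbardTorus 2 L 1 U - (c : ℂ) • ((pairField sWave L)ᴴ * pairField sWave L) -
      hubbardTorus 2 L 1 (U - 2 * (L : ℝ) ^ 2 * c) =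
        (c : ℂ) • ((2 * (L : ℂ) ^ 2) • hubbardTorus 2 L 0 1 - (pairField sWave L)ᴴ * pairField sWave L) := by
    rw [hubbardTorus_eq_zero_add_smul_interaction (L := L) U,
      hubbardTorus_eq_zero_add_smul_interaction (L := L) (U - _),
      hD, smul_sub, smul_smul, Complex.ofReal_sub, sub_smul]
    push_cast
    rw [show (2 * (L : ℂ) ^ 2 * (c : ℂ)) = (c : ℂ) * (2 * (L : ℂ) ^ 2) by ring]
    abel
  rw [key]
  exact (reducedChannelDomination L).smul (Complex.zero_le_real.2 hc)

end Absorb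

/-! ### Energies: Loewner monotonicity, the on-site secant, and the coupling-transport ceiling -/

section Energies

variable {n : Type*} [Fintype n] [DecidableEq n]

/-- **Loewner monotonicity of sector energies.** If `A − B` is positive semidefinite and `B` is Hermitian,
then `minEnergyOn B K ≤ minEnergyOn A K` for every sector `K` (for `K = ⊥` both sides are the junk value
`sInf ∅ = 0`). Tasaki (2020) §2.2 (variational principle in a sector). [folklore] -/
theorem minEnergyOn_mono_of_posSemidef_sub {A B : Matrix n n ℂ} (hB : B.IsHermitian)
    (hAB : (A - B).PosSemidef) (K : Submodule ℂ (n → ℂ)) : B.minEnergyOn K ≤ A.minEnergyOn K := by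
  by_cases hK : K = ⊥
  · subst hK
    have hempty : ∀ M : Matrix n n ℂ,
        {E : ℝ | ∃ ψ ∈ (⊥ : Submodule ℂ (n → ℂ)), star ψ ⬝ᵥ ψ = 1 ∧ E = (star ψ ⬝ᵥ M *ᵥ ψ).re} = ∅ := by
      intro M
      ext E
      simp only [Submodule.mem_bot, Set.mem_setOf_eq, Set.mem_empty_iff_false, iff_false]
      rintro ⟨ψ, rfl, h1, -⟩
      simp at h1
    simp only [Matrix.minEnergyOn, hempty, Real.sInf_empty, le_refl]
  · obtain ⟨w, hwK, hw0⟩ := Submodule.exists_mem_ne_zero_of_ne_bot hK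
    obtain ⟨c, -, hc1⟩ := exists_smul_unit hw0
    refine le_csInf ⟨_, c • w, K.smul_mem c hwK, hc1, rfl⟩ ?_
    rintro _ ⟨ψ, hψ, hψ1, rfl⟩
    refine (minEnergyOn_le_rayleigh_of_mem hB K hψ hψ1).trans ?_
    have h := (Complex.le_def.1 (hAB.dotProduct_mulVec_nonneg ψ)).1
    rw [sub_mulVec, dotProduct_sub, Complex.sub_re, Complex.zero_re, sub_nonneg] at h
    exact h

/-- **On-site secant** (one-sided Feynman–Hellmann for Shastry's coupling `x ↦ H + x·P_sᴴP_s` at `x = 0`;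
`OnsiteSecant` of crux idea `shastry-secant-reduced-bcs`, in variational form): for a Hermitian `H`, a sector
`K`, a unit vector `ψ ∈ K` realising `minEnergyOn H K`, any matrix `P` and any real `c`,
`c · Re⟨ψ, PᴴP ψ⟩ ≤ minEnergyOn H K − minEnergyOn (H − c·PᴴP) K` (`ψ` is a trial state for `H − c·PᴴP`).
Shastry, J. Phys. A 30 (1997) L635, eq. (1); Griffiths, Phys. Rev. 152 (1966) 240, §II. [folklore] -/
theorem smul_re_expect_le_minEnergyOn_sub {H : Matrix n n ℂ} (hH : H.IsHermitian) (P : Matrix n n ℂ)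
    (c : ℝ) (K : Submodule ℂ (n → ℂ)) {ψ : n → ℂ} (hψK : ψ ∈ K) (hψ : star ψ ⬝ᵥ ψ = 1)
    (hground : (star ψ ⬝ᵥ H *ᵥ ψ).re = H.minEnergyOn K) :
    c * (star ψ ⬝ᵥ (Pᴴ * P) *ᵥ ψ).re ≤
      H.minEnergyOn K - (H - (c : ℂ) • (Pᴴ * P)).minEnergyOn K := by
  have hPP : (Pᴴ * P).IsHermitian := isHermitian_conjTranspose_mul_self P
  have hsm : ((c : ℂ) • (Pᴴ * P)).IsHermitian := by
    unfold Matrix.IsHermitian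
    rw [conjTranspose_smul, hPP.eq, Complex.star_def, Complex.conj_ofReal]
  have hherm : (H - (c : ℂ) • (Pᴴ * P)).IsHermitian := hH.sub hsm
  have hle := minEnergyOn_le_rayleigh_of_mem hherm K hψK hψ
  rw [sub_mulVec, dotProduct_sub, Complex.sub_re, hground, smul_mulVec, dotProduct_smul, smul_eq_mul,
    Complex.re_ofReal_mul] at hle
  linarith

end Energies

section TorusEnergies

variable (L : ℕ) [NeZero L]

/-- **A reduced `s`-wave BCS attraction lowers sector energies no more than weakening `U` does**: for
`c ≥ 0`, every real `U` and every sector `K`,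
`minEnergyOn (hubbardTorus 2 L 1 (U − 2L²c)) K ≤ minEnergyOn (hubbardTorus 2 L 1 U − c·P_sᴴP_s) K`
(Loewner monotonicity applied to `posSemidef_hubbardTorus_sub_smul_pairField_sub`). With `g = 2L²c` this reads
`E_K(H_U − (g/L²)η₀ᴴη₀) ≥ E_K(H_{U−g})`. [folklore] -/
theorem minEnergyOn_hubbardTorus_shift_le (U c : ℝ) (hc : 0 ≤ c)
    (K : Submodule ℂ (Fock (Orb (FermionTorus 2 L)))) :
    (hubbardTorus 2 L 1 (U - 2 * (L : ℝ) ^ 2 * c)).minEnergyOn K ≤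
      (hubbardTorus 2 L 1 U - (c : ℂ) • ((pairField sWave L)ᴴ * pairField sWave L)).minEnergyOn K :=
  minEnergyOn_mono_of_posSemidef_sub (LiebThm1.hamiltonian_isHermitian (fermionTorusGraph 2 L) 1 _)
    (posSemidef_hubbardTorus_sub_smul_pairField_sub L U c hc) K

/-- **Coupling-transport ceiling** (census T4 of crux `NoOnsiteODLRO`, made unconditional): for every real
`U`, every `g > 0`, every sector `(N, S^z = M)` and every unit ground EIGENvector `ψ` of `hubbardTorus 2 L 1 U`
in that sector,

  `(g / (2L²)) · Re⟨ψ, P_sᴴP_s ψ⟩ ≤ E(U) − E(U − g)`,   `E(V) = minEnergyOn (hubbardTorus 2 L 1 V) (szSector N M)`,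

i.e. `S ≤ (2L²/g)·(E(U) − E(U−g))`: the on-site pair structure factor of ANY ground state is at most `2L²`
times a secant slope of the (concave) sector energy in the coupling — on-site secant plus reduced-channel
domination. No pair window, no `U`-shift of the spectrum, no Falk–Bruch step. As `g ↓ 0` the right-hand side
tends to `2L²·∂⁻_U E = 2L²·max_GS ⟨D⟩`, so this never beats `O(L⁴)` (STRATEGY-CENSUS T4: circular for the
crux), but it is the exact inequality behind the card's transfer `crux ⇐ ReducedBCSStability` with the
repulsion spent once. Shastry (1997) eq. (1); Griffiths (1966) §II; Yang (1962) §3. [folklore] -/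
theorem re_expect_pairField_sWave_le_couplingSecant (U : ℝ) {g : ℝ} (hg : 0 < g) (N : ℕ) (M : ℝ)
    {ψ : Fock (Orb (FermionTorus 2 L))} (hψ1 : star ψ ⬝ᵥ ψ = 1)
    (hψ : IsGroundStateInSector (hubbardTorus 2 L 1 U) N M ψ) :
    g / (2 * (L : ℝ) ^ 2) * (expect ((pairField sWave L)ᴴ * pairField sWave L) ψ).re ≤
      (hubbardTorus 2 L 1 U).minEnergyOn (szSector (Λ := FermionTorus 2 L) N M) -
        (hubbardTorus 2 L 1 (U - g)).minEnergyOn (szSector (Λ := FermionTorus 2 L) N M) := by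
  obtain ⟨hmem, -, heig⟩ := hψ
  have hH : (hubbardTorus 2 L 1 U).IsHermitian := LiebThm1.hamiltonian_isHermitian (fermionTorusGraph 2 L) 1 U
  have hground : (star ψ ⬝ᵥ (hubbardTorus 2 L 1 U) *ᵥ ψ).re =
      (hubbardTorus 2 L 1 U).minEnergyOn (szSector (Λ := FermionTorus 2 L) N M) := by
    rw [heig, dotProduct_smul, hψ1, smul_eq_mul, mul_one, Complex.ofReal_re]
  set c : ℝ := g / (2 * (L : ℝ) ^ 2) with hc
  have hL : (0 : ℝ) < (L : ℝ) := by exact_mod_cast Nat.pos_of_ne_zero (NeZero.ne L)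
  have hc0 : 0 ≤ c := by positivity
  have hsec := smul_re_expect_le_minEnergyOn_sub hH (pairField sWave L) c (szSector N M) hmem hψ1 hground
  have hshift := minEnergyOn_hubbardTorus_shift_le L U c hc0 (szSector N M)
  have hUg : U - 2 * (L : ℝ) ^ 2 * c = U - g := by
    rw [hc]; field_simp
  rw [hUg] at hshift
  change c * (star ψ ⬝ᵥ ((pairField sWave L)ᴴ * pairField sWave L) *ᵥ ψ).re ≤ _
  linarith

/-- **Griffiths antitonicity, on-site form**: for `U' < U`, every unit ground eigenvector `ψ` of
`hubbardTorus 2 L 1 U` and every unit ground eigenvector `φ` of `hubbardTorus 2 L 1 U'` in the same sector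
`(N, S^z = M)`,  `Re⟨ψ, P_sᴴP_s ψ⟩ ≤ 2L² · Re⟨φ, D φ⟩`  (`D = hubbardTorus 2 L 0 1 = Σ_x n_{x↑}n_{x↓}`): the
on-site pair structure factor at coupling `U` is dominated by the doublon number of ANY ground state at ANY
weaker coupling (coupling-transport ceiling + the supergradient inequality `E(U) − E(U') ≤ (U − U')⟨D⟩_φ`).
Griffiths, Phys. Rev. 152 (1966) 240, §II; Tasaki (1998) §5.1. [folklore] -/
theorem re_expect_pairField_sWave_le_doublon_of_lt {U U' : ℝ} (hU : U' < U) (N : ℕ) (M : ℝ)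
    {ψ φ : Fock (Orb (FermionTorus 2 L))} (hψ1 : star ψ ⬝ᵥ ψ = 1)
    (hψ : IsGroundStateInSector (hubbardTorus 2 L 1 U) N M ψ) (hφ1 : star φ ⬝ᵥ φ = 1)
    (hφ : IsGroundStateInSector (hubbardTorus 2 L 1 U') N M φ) :
    (expect ((pairField sWave L)ᴴ * pairField sWave L) ψ).re ≤
      2 * (L : ℝ) ^ 2 * (expect (hubbardTorus 2 L 0 1) φ).re := by
  have hg : 0 < U - U' := sub_pos.2 hU
  have h1 := re_expect_pairField_sWave_le_couplingSecant L U hg N M hψ1 hψ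
  rw [sub_sub_cancel] at h1
  -- supergradient at `U'` with trial state `φ` for `H_U = H_{U'} + (U - U') • D`
  obtain ⟨hφmem, -, hφeig⟩ := hφ
  have hH : (hubbardTorus 2 L 1 U).IsHermitian := LiebThm1.hamiltonian_isHermitian (fermionTorusGraph 2 L) 1 U
  have hφground : (star φ ⬝ᵥ (hubbardTorus 2 L 1 U') *ᵥ φ).re =
      (hubbardTorus 2 L 1 U').minEnergyOn (szSector (Λ := FermionTorus 2 L) N M) := by
    rw [hφeig, dotProduct_smul, hφ1, smul_eq_mul, mul_one, Complex.ofReal_re]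
  have hvar := minEnergyOn_le_rayleigh_of_mem hH (szSector N M) hφmem hφ1
  have hsplit : hubbardTorus 2 L 1 U = hubbardTorus 2 L 1 U' + ((U - U' : ℝ) : ℂ) • hubbardTorus 2 L 0 1 := by
    rw [hubbardTorus_eq_zero_add_smul_interaction (L := L) U,
      hubbardTorus_eq_zero_add_smul_interaction (L := L) U', hubbardTorus_zero_one_eq_sum_doublon,
      add_assoc, ← add_smul]
    push_cast
    ring_nf
  have hexp : (star φ ⬝ᵥ (hubbardTorus 2 L 1 U) *ᵥ φ).re =
      (hubbardTorus 2 L 1 U').minEnergyOn (szSector (Λ := FermionTorus 2 L) N M) +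
        (U - U') * (expect (hubbardTorus 2 L 0 1) φ).re := by
    rw [hsplit, add_mulVec, dotProduct_add, Complex.add_re, hφground, smul_mulVec, dotProduct_smul,
      smul_eq_mul, Complex.re_ofReal_mul]
    rfl
  rw [hexp] at hvar
  have hL : (0 : ℝ) < (L : ℝ) := by exact_mod_cast Nat.pos_of_ne_zero (NeZero.ne L)
  have hL2 : (0 : ℝ) < 2 * (L : ℝ) ^ 2 := by positivity
  -- h1 : (U-U')/(2L²) · S ≤ E(U) − E(U');  hvar : E(U) ≤ E(U') + (U-U') · ⟨D⟩_φ
  set S := (expect ((pairField sWave L)ᴴ * pairField sWave L) ψ).re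
  set d := (expect (hubbardTorus 2 L 0 1) φ).re
  have key : (U - U') / (2 * (L : ℝ) ^ 2) * S ≤ (U - U') * d := by linarith
  have key2 : (U - U') * S ≤ (U - U') * (2 * (L : ℝ) ^ 2 * d) := by
    have h := mul_le_mul_of_nonneg_left key hL2.le
    calc (U - U') * S = 2 * (L : ℝ) ^ 2 * ((U - U') / (2 * (L : ℝ) ^ 2) * S) := by
          field_simp
      _ ≤ 2 * (L : ℝ) ^ 2 * ((U - U') * d) := h
      _ = (U - U') * (2 * (L : ℝ) ^ 2 * d) := by ring
  exact le_of_mul_le_mul_left key2 hg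

end TorusEnergies

/-! ### Registered helper stub -/

/-- **Registered helper stub `stub_couplingTransportCeiling`** of crux `NoOnsiteODLRO`
(stmt-HubbardSuperconductivity-0933; census by-product T4 made unconditional, NOT a piece of any line's
composition `NoOnsiteODLRO_of`): for every side `L ≥ 1`, real `U`, `g > 0`, sector `(N, S^z = M)` and unit
ground eigenvector `ψ` of `hubbardTorus 2 L 1 U` in that sector,
`(g / (2L²)) · Re⟨ψ, P_sᴴP_s ψ⟩ ≤ E(U) − E(U − g)`, `E(V) = minEnergyOn (hubbardTorus 2 L 1 V) (szSector N M)`.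
Shastry (1997) eq. (1); Griffiths (1966) §II. [folklore] -/
theorem stub_couplingTransportCeiling : ∀ (L : ℕ) [NeZero L] (U g : ℝ), 0 < g → ∀ (N : ℕ) (M : ℝ)
    (ψ : Fock (Orb (FermionTorus 2 L))), star ψ ⬝ᵥ ψ = 1 →
    IsGroundStateInSector (hubbardTorus 2 L 1 U) N M ψ →
    g / (2 * (L : ℝ) ^ 2) * (expect ((pairField sWave L)ᴴ * pairField sWave L) ψ).re ≤
      (hubbardTorus 2 L 1 U).minEnergyOn (szSector (Λ := FermionTorus 2 L) N M) -
        (hubbardTorus 2 L 1 (U - g)).minEnergyOn (szSector (Λ := FermionTorus 2 L) N M) :=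
  fun L _ U _ hg N M _ hψ1 hψ => re_expect_pairField_sWave_le_couplingSecant L U hg N M hψ1 hψ


end Summit.HubbardSuperconductivity.HubbardSuperconductivity.Theorems.NoOnsiteODLRO.ReducedChannel
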